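import Summits.Parity.BatemanHorn.Theorems.SoloInformedTwinPairSum
import Summits.Parity.BatemanHorn.Theorems.SoloInformedTwinPrimeLocalisation

/-!
# SoloInformedTwinBalancedSplit — the balanced / unbalanced split of the located twin sum;
# Hardy–Littlewood for prime pairs as a statement about the BALANCED FAR TAIL

Solo unit `solo-Parity-informed` (ideation tier, informed mode), session 44; `paper.md` §20
(Theorem 20.1 = (F′), Theorem 20.9 = (F), Corollaries 20.3–20.4), `SHARPEST-STATEMENT.md` §2
Theorem F and §4L, CLAIMS C120.

The kernel theorem `twinPrime_isEquivalent_iff_tail_isLittleO` (C89) says: the Hardy–Littlewood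
twin prime asymptotic `π₂(x) ~ 2C₂ x / log² x` holds iff the LOCATED TWIN SUM
`T(x; y) = ∑_{n ≤ x} ∑_{e ∣ n(n+2), e > y} μ(e) log² e` is `o(x)` (cut `y = ⌊x^{1-ε}⌋`), and
`twinLocatedSum_eq_sum_pairs` (C118) writes `T(x; y)` as a sum over divisor pairs
`(e₁ ∣ n, e₂ ∣ n+2)`.  The prose Theorem F of the programme (paper.md §20) then splits the pairs
three ways —

* UNBALANCED pairs, `min(e₁, e₂) ≤ z` (prose (F′): `o(x)`, indeed `≪ x (log x)^{-A}`, for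
  `z = x^{1/2-ε₀}`, by Bombieri–Vinogradov for `μ` and `μ ⋆ 1`-convolutions);
* BALANCED pairs in the WINDOW, `min(e₁, e₂) > z`, `e₁e₂ ≤ Y` (prose (F): `≪ x^{1-δ}` for
  `Y = x^{1+η}`, every fixed `η < 1/15`, by averaged Kloosterman sums with Möbius variable
  [Ir14, Thm 1.3], Weil/Ramanujan sums);
* the BALANCED FAR TAIL, `min(e₁, e₂) > z`, `e₁e₂ > Y` —

and concludes `HL₂ ⟺ (balanced far tail) = o(x)`.  This file puts the DEDUCTION in the kernel,
for arbitrary cut / balance / level functions `y, z, Y : ℕ → ℕ`, with the two analytic inputs as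
hypotheses about kernel-defined quantities (nothing analytic is proved here):

* `twinLocatedSum`, `twinPairTerm`, `twinUnbalancedSum`, `twinBalancedWindowSum`,
  `twinBalancedFarSum` — the objects, and the exact identity
  `twinLocatedSum_eq_unbalanced_add_window_add_far` (every `x, y, z, Y`);
* `twinPrime_iff_locatedSum_isLittleO` — C89 for an ARBITRARY admissible cut `y → ∞`,
  `y log³ y = o(x)` (e.g. `x^{1-ε}`, `x (log x)^{-4}`);
* `twinPrime_iff_balancedFarSum_isLittleO` — for every admissible cut `y` and every `z, Y`:
  if the unbalanced part and the balanced window are `o(x)`, then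
  `π₂(x) ~ 2C₂x/log²x ⟺ twinBalancedFarSum = o(x)`;
* `twinPrime_iff_balancedFarTail_rpow` — the two prose inputs (F′), (F) TYPED as its hypotheses
  with the prose parameters `y = ⌊x^{1-ε}⌋`, `z = ⌊x^{1/2-ε₀}⌋`, `Y = ⌊x^{1+η}⌋` (`rpowCut`,
  `balanceCut`, `productLevel`): under them, HL₂ ⟺
  `∑_{e₁,e₂ > x^{1/2-ε₀}, e₁e₂ > x^{1+η}} μ(e₁)μ(e₂) log²(e₁e₂) N(e₁,e₂;x) = o(x)`
  — pair-Chowla with balanced cofactors, the open statement for prime pairs in `T`-coordinates.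

Also recorded: pairs with `e₁e₂ > (x+2)²` never occur (`twinBalancedFarSum_eq_zero_of_sq_le`), so
the far tail lives on `Y < e₁e₂ ≤ (x+2)²`.  Deliberately NOT here: any estimate towards (F′)/(F).
-/

namespace Summit.Parity.BatemanHorn.Theorems

open Finset Filter Asymptotics ArithmeticFunction Polynomial
open scoped ArithmeticFunction.Moebius
open Literature.NumberTheory.Sieve

/-! ### 1. The objects -/

/-- The located twin sum `T(x; y) = ∑_{n ≤ x} ∑_{e ∣ n(n+2), e > y} μ(e) log² e` (C89). -/
noncomputable def twinLocatedSum (x y : ℕ) : ℝ :=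
  ∑ n ∈ Icc 1 x, ∑ e ∈ (n * (n + 2)).divisors with y < e, (μ e : ℝ) * Real.log e ^ 2

/-- The pair count `N(e₁,e₂;x) = #{n ≤ x odd : e₁ ∣ n, e₂ ∣ n+2} + #{m ≤ x/2 : e₁ ∣ m, e₂ ∣ m+1}`
(C117/C118: residue-class counts to modulus `2e₁e₂` resp. `e₁e₂`). -/
noncomputable def twinPairCount (x e₁ e₂ : ℕ) : ℝ :=
  (#{n ∈ (Icc 1 x).filter Odd | e₁ ∣ n ∧ e₂ ∣ n + 2} : ℝ)
    + #{m ∈ Icc 1 (x / 2) | e₁ ∣ m ∧ e₂ ∣ m + 1}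

/-- The contribution of the divisor pair `(e₁, e₂)` to `T(x; y)`:
`𝟙[e₁e₂ > y] μ(e₁)μ(e₂) log²(e₁e₂) · N(e₁,e₂;x)`. -/
noncomputable def twinPairTerm (x y e₁ e₂ : ℕ) : ℝ :=
  (if y < e₁ * e₂ then (μ e₁ : ℝ) * μ e₂ * Real.log (e₁ * e₂ : ℕ) ^ 2 else 0) * twinPairCount x e₁ e₂

/-- UNBALANCED part of `T(x; y)`: pairs with `min(e₁, e₂) ≤ z`. -/
noncomputable def twinUnbalancedSum (x y z : ℕ) : ℝ :=
  ∑ e₁ ∈ Icc 1 (x + 2), ∑ e₂ ∈ Icc 1 (x + 2),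
    if min e₁ e₂ ≤ z then twinPairTerm x y e₁ e₂ else 0

/-- BALANCED WINDOW of `T(x; y)`: pairs with `min(e₁, e₂) > z` and `e₁e₂ ≤ Y`. -/
noncomputable def twinBalancedWindowSum (x y z Y : ℕ) : ℝ :=
  ∑ e₁ ∈ Icc 1 (x + 2), ∑ e₂ ∈ Icc 1 (x + 2),
    if z < min e₁ e₂ ∧ e₁ * e₂ ≤ Y then twinPairTerm x y e₁ e₂ else 0

/-- BALANCED FAR TAIL of `T(x; y)`: pairs with `min(e₁, e₂) > z` and `e₁e₂ > Y`. -/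
noncomputable def twinBalancedFarSum (x y z Y : ℕ) : ℝ :=
  ∑ e₁ ∈ Icc 1 (x + 2), ∑ e₂ ∈ Icc 1 (x + 2),
    if z < min e₁ e₂ ∧ Y < e₁ * e₂ then twinPairTerm x y e₁ e₂ else 0

/-! ### 2. The exact three-way split -/

/-- `T(x; y)` in pair coordinates (C118, restated with the named objects). -/
theorem twinLocatedSum_eq_sum_pairTerm (x y : ℕ) :
    twinLocatedSum x y = ∑ e₁ ∈ Icc 1 (x + 2), ∑ e₂ ∈ Icc 1 (x + 2), twinPairTerm x y e₁ e₂ :=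
  twinLocatedSum_eq_sum_pairs x y

/-- Pointwise three-way split of a pair's contribution. -/
theorem eq_ite_unbalanced_add_ite_window_add_ite_far (t : ℝ) (z Y e₁ e₂ : ℕ) :
    t = (if min e₁ e₂ ≤ z then t else 0)
          + (if z < min e₁ e₂ ∧ e₁ * e₂ ≤ Y then t else 0)
          + (if z < min e₁ e₂ ∧ Y < e₁ * e₂ then t else 0) := by
  by_cases h1 : min e₁ e₂ ≤ z
  · have h2 : ¬(z < min e₁ e₂ ∧ e₁ * e₂ ≤ Y) := fun h => absurd h.1 (not_lt.mpr h1)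
    have h3 : ¬(z < min e₁ e₂ ∧ Y < e₁ * e₂) := fun h => absurd h.1 (not_lt.mpr h1)
    rw [if_pos h1, if_neg h2, if_neg h3, add_zero, add_zero]
  · have h1' : z < min e₁ e₂ := not_le.mp h1
    by_cases hY : e₁ * e₂ ≤ Y
    · have h2 : z < min e₁ e₂ ∧ e₁ * e₂ ≤ Y := ⟨h1', hY⟩
      have h3 : ¬(z < min e₁ e₂ ∧ Y < e₁ * e₂) := fun h => absurd h.2 (not_lt.mpr hY)
      rw [if_neg h1, if_pos h2, if_neg h3, zero_add, add_zero]
    · have h2 : ¬(z < min e₁ e₂ ∧ e₁ * e₂ ≤ Y) := fun h => hY h.2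
      have h3 : z < min e₁ e₂ ∧ Y < e₁ * e₂ := ⟨h1', not_le.mp hY⟩
      rw [if_neg h1, if_neg h2, if_pos h3, zero_add, zero_add]

/-- **The split.**  For every `x, y, z, Y`:
`T(x; y) = (unbalanced, min ≤ z) + (balanced window, e₁e₂ ≤ Y) + (balanced far tail, e₁e₂ > Y)`. -/
theorem twinLocatedSum_eq_unbalanced_add_window_add_far (x y z Y : ℕ) :
    twinLocatedSum x y
      = twinUnbalancedSum x y z + twinBalancedWindowSum x y z Y + twinBalancedFarSum x y z Y := by
  rw [twinLocatedSum_eq_sum_pairTerm, twinUnbalancedSum, twinBalancedWindowSum, twinBalancedFarSum,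
    ← sum_add_distrib, ← sum_add_distrib]
  refine sum_congr rfl fun e₁ _ => ?_
  rw [← sum_add_distrib, ← sum_add_distrib]
  refine sum_congr rfl fun e₂ _ => ?_
  exact eq_ite_unbalanced_add_ite_window_add_ite_far _ z Y e₁ e₂

/-- Pairs with `e₁e₂ > (x+2)²` do not occur: the far tail beyond `(x+2)²` is empty. -/
theorem twinBalancedFarSum_eq_zero_of_sq_le (x y z Y : ℕ) (hY : (x + 2) ^ 2 ≤ Y) :
    twinBalancedFarSum x y z Y = 0 := by
  refine sum_eq_zero fun e₁ he₁ => sum_eq_zero fun e₂ he₂ => ?_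
  have h1 := (mem_Icc.mp he₁).2
  have h2 := (mem_Icc.mp he₂).2
  have hprod : e₁ * e₂ ≤ (x + 2) ^ 2 := by
    rw [sq]; exact Nat.mul_le_mul h1 h2
  have h : ¬(z < min e₁ e₂ ∧ Y < e₁ * e₂) := fun h => absurd (hY.trans_lt h.2) (not_lt.mpr hprod)
  rw [if_neg h]

/-- Pairs with `e₁ > x` contribute nothing to any of the three parts: both counts vanish
(`e₁ ∣ n ≤ x` resp. `e₁ ∣ m ≤ x/2`). -/
theorem twinPairCount_eq_zero_of_lt {x e₁ : ℕ} (h : x < e₁) (e₂ : ℕ) :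
    twinPairCount x e₁ e₂ = 0 := by
  have hA : #{n ∈ (Icc 1 x).filter Odd | e₁ ∣ n ∧ e₂ ∣ n + 2} = 0 :=
    card_eq_zero.mpr (filter_eq_empty_iff.mpr fun n hn hd => by
      have hn' := mem_Icc.mp (mem_filter.mp hn).1
      have := Nat.le_of_dvd (by omega) hd.1
      omega)
  have hB : #{m ∈ Icc 1 (x / 2) | e₁ ∣ m ∧ e₂ ∣ m + 1} = 0 :=
    card_eq_zero.mpr (filter_eq_empty_iff.mpr fun m hm hd => by
      have hm' := mem_Icc.mp hm
      have := Nat.le_of_dvd (by omega) hd.1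
      omega)
  simp [twinPairCount, hA, hB]

/-! ### 3. Asymptotic bookkeeping -/

/-- If `T = U + W + R` with `U, W = o(g)`, then `T = o(g) ⟺ R = o(g)`. -/
theorem isLittleO_iff_of_eq_add_add {T U W R g : ℕ → ℝ} (hT : ∀ x, T x = U x + W x + R x)
    (hU : U =o[atTop] g) (hW : W =o[atTop] g) :
    T =o[atTop] g ↔ R =o[atTop] g := by
  constructor
  · intro h
    have hR : R = fun x => T x - U x - W x := funext fun x => by rw [hT x]; ring
    rw [hR]
    exact (h.sub hU).sub hW
  · intro h
    have hT' : T = fun x => U x + W x + R x := funext hT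
    rw [hT']
    exact (hU.add hW).add h

/-- For ANY cut, balance threshold and level `y, z, Y : ℕ → ℕ`: if the unbalanced part and the
balanced window are `o(x)`, then `T(x; y) = o(x) ⟺ balanced far tail = o(x)`. -/
theorem twinLocatedSum_isLittleO_iff_balancedFarSum (y z Y : ℕ → ℕ)
    (hU : (fun x => twinUnbalancedSum x (y x) (z x)) =o[atTop] fun x : ℕ => (x : ℝ))
    (hW : (fun x => twinBalancedWindowSum x (y x) (z x) (Y x)) =o[atTop] fun x : ℕ => (x : ℝ)) :
    (fun x => twinLocatedSum x (y x)) =o[atTop] (fun x : ℕ => (x : ℝ)) ↔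
      (fun x => twinBalancedFarSum x (y x) (z x) (Y x)) =o[atTop] fun x : ℕ => (x : ℝ) :=
  isLittleO_iff_of_eq_add_add
    (fun x => twinLocatedSum_eq_unbalanced_add_window_add_far x (y x) (z x) (Y x)) hU hW

/-! ### 4. Hardy–Littlewood for prime pairs, localised on the balanced far tail -/

/-- C89 for an ARBITRARY admissible cut: if `y(x) → ∞` and `y log³ y = o(x)` then
`π₂(x) ~ 2C₂x/log²x ⟺ T(x; y(x)) = o(x)`. -/
theorem twinPrime_iff_locatedSum_isLittleO {y : ℕ → ℕ} (hy : Tendsto y atTop atTop)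
    (hy' : (fun x : ℕ => (y x : ℝ) * Real.log (y x) ^ 3) =o[atTop] fun x : ℕ => (x : ℝ)) :
    (fun x : ℕ => (twinPrimeCount x : ℝ)) ~[atTop]
        (fun x : ℕ => 2 * twinPrimeConst * x / Real.log x ^ 2) ↔
      (fun x => twinLocatedSum x (y x)) =o[atTop] fun x : ℕ => (x : ℝ) := by
  have hy3 : (fun x : ℕ => (y x : ℝ) * Real.log (y x) ^ (Fintype.card (Fin 2) - 1 + Fintype.card (Fin 2)))
      =o[atTop] fun x : ℕ => (x : ℝ) := by
    simpa using hy'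
  rw [← batemanHornAsymptotic_twinSystem_iff,
    batemanHornAsymptotic_iff_tail_isLittleO isBatemanHornSystem_twinSystem hy hy3]
  have hF : ∀ n : ℕ, (((∏ i, twinSystem i).eval (n : ℤ)).natAbs) = n * (n + 2) := by
    intro n
    have h : (∏ i, twinSystem i).eval (n : ℤ) = ((n * (n + 2) : ℕ) : ℤ) := by
      simp only [twinSystem, Fin.prod_univ_two, Matrix.cons_val_zero, Matrix.cons_val_one,
        eval_mul, eval_X, eval_add, eval_ofNat]
      push_cast
      ring
    rw [h, Int.natAbs_natCast]
  simp_rw [hF, Fintype.card_fin]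
  rfl

/-- **HL₂ ⟺ balanced far tail**, general form.  For every admissible cut `y` (`y → ∞`,
`y log³ y = o(x)`) and every `z, Y : ℕ → ℕ`: if the unbalanced pairs (`min(e₁,e₂) ≤ z`) and the
balanced window (`e₁e₂ ≤ Y`) contribute `o(x)` to `T(x; y)`, then
`π₂(x) ~ 2C₂x/log²x ⟺ ∑_{min(e₁,e₂) > z, e₁e₂ > Y} 𝟙[e₁e₂ > y] μ(e₁)μ(e₂)log²(e₁e₂) N(e₁,e₂;x) = o(x)`. -/
theorem twinPrime_iff_balancedFarSum_isLittleO {y z Y : ℕ → ℕ} (hy : Tendsto y atTop atTop)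
    (hy' : (fun x : ℕ => (y x : ℝ) * Real.log (y x) ^ 3) =o[atTop] fun x : ℕ => (x : ℝ))
    (hU : (fun x => twinUnbalancedSum x (y x) (z x)) =o[atTop] fun x : ℕ => (x : ℝ))
    (hW : (fun x => twinBalancedWindowSum x (y x) (z x) (Y x)) =o[atTop] fun x : ℕ => (x : ℝ)) :
    (fun x : ℕ => (twinPrimeCount x : ℝ)) ~[atTop]
        (fun x : ℕ => 2 * twinPrimeConst * x / Real.log x ^ 2) ↔
      (fun x => twinBalancedFarSum x (y x) (z x) (Y x)) =o[atTop] fun x : ℕ => (x : ℝ) := by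
  rw [twinPrime_iff_locatedSum_isLittleO hy hy']
  exact twinLocatedSum_isLittleO_iff_balancedFarSum y z Y hU hW

/-! ### 5. The typed corollary with the prose parameters -/

/-- The standard cut `⌊x^{1-ε}⌋`. -/
noncomputable def rpowCut (ε : ℝ) (x : ℕ) : ℕ := ⌊(x : ℝ) ^ (1 - ε)⌋₊

/-- The balance threshold `⌊x^{1/2-ε₀}⌋`. -/
noncomputable def balanceCut (ε₀ : ℝ) (x : ℕ) : ℕ := ⌊(x : ℝ) ^ (1 / 2 - ε₀)⌋₊

/-- The product level `⌊x^{1+η}⌋`. -/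
noncomputable def productLevel (η : ℝ) (x : ℕ) : ℕ := ⌊(x : ℝ) ^ (1 + η)⌋₊

/-- **Typed corollary (paper.md Cor. 20.3/20.4 in the kernel, modulo the two prose inputs, which
appear here as the hypotheses `hU`, `hW` with their exact types).**

* `hU` = (F′) of paper.md §20 (Theorem 20.1), TYPED: the unbalanced pairs `min(e₁,e₂) ≤ x^{1/2-ε₀}`
  of the located twin sum with cut `x^{1-ε}` contribute `o(x)` — a PROSE theorem (Bombieri–Vinogradov
  for `μ` and `μ ⋆ 1`-convolutions, Siegel–Walfisz), NOT proved in the kernel;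
* `hW` = (F) of paper.md §20 (Theorem 20.9, every fixed `η < 1/15`, suitable `ε₀ = ε₀(η) > 0`), TYPED:
  the balanced pairs with `e₁e₂ ≤ x^{1+η}` contribute `o(x)` — a PROSE theorem ([Ir14, Thm 1.3]
  adapted to `μ`, Weil, Ramanujan sums, Beurling–Selberg), NOT proved in the kernel.

Conclusion: for `0 < ε < 1` and any `ε₀, η`, under (F′) and (F),
`π₂(x) ~ 2C₂x/log²x ⟺ ∑_{e₁,e₂ > x^{1/2-ε₀}, e₁e₂ > x^{1+η}} μ(e₁)μ(e₂) log²(e₁e₂) N(e₁,e₂;x) = o(x)`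
— the balanced far tail, i.e. pair-Chowla with balanced cofactors `m₁m₂ < x^{1-η}`. -/
theorem twinPrime_iff_balancedFarTail_rpow {ε : ℝ} (hε : 0 < ε) (hε1 : ε < 1) {ε₀ η : ℝ}
    (hU : (fun x => twinUnbalancedSum x (rpowCut ε x) (balanceCut ε₀ x))
      =o[atTop] fun x : ℕ => (x : ℝ))
    (hW : (fun x => twinBalancedWindowSum x (rpowCut ε x) (balanceCut ε₀ x) (productLevel η x))
      =o[atTop] fun x : ℕ => (x : ℝ)) :
    (fun x : ℕ => (twinPrimeCount x : ℝ)) ~[atTop]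
        (fun x : ℕ => 2 * twinPrimeConst * x / Real.log x ^ 2) ↔
      (fun x => twinBalancedFarSum x (rpowCut ε x) (balanceCut ε₀ x) (productLevel η x))
        =o[atTop] fun x : ℕ => (x : ℝ) :=
  twinPrime_iff_balancedFarSum_isLittleO (y := rpowCut ε) (z := balanceCut ε₀) (Y := productLevel η)
    (tendsto_rpowCut_atTop hε1) (rpowCut_mul_log_pow_isLittleO hε hε1 3) hU hW

/-- Unconditionally, the three parts always sum to the located sum with the standard parameters
(sanity restatement of the split for the typed objects). -/
theorem twinLocatedSum_rpowCut_eq (ε ε₀ η : ℝ) (x : ℕ) :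
    twinLocatedSum x (rpowCut ε x)
      = twinUnbalancedSum x (rpowCut ε x) (balanceCut ε₀ x)
        + twinBalancedWindowSum x (rpowCut ε x) (balanceCut ε₀ x) (productLevel η x)
        + twinBalancedFarSum x (rpowCut ε x) (balanceCut ε₀ x) (productLevel η x) :=
  twinLocatedSum_eq_unbalanced_add_window_add_far _ _ _ _

end Summit.Parity.BatemanHorn.Theorems
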